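import Summits.QuantumFields.YangMills.Theorems.BalabanLadderInfVolCeilingsDefs
import Summits.QuantumFields.YangMills.Theorems.BalabanLadderInfVolFloorsDefs
import Summits.QuantumFields.YangMills.Theorems.ContractibleFibreFibreToTorusStubTorusLimitTranslationInvariant
import HarnessLib

/-!
# Lattice translation invariance of the infinite-volume correlation data `stateMomentStr`, `stateCov`, `stateK3`

HONEST FRAMING (R136 (i) «parallel continuum programme», seat `ym-infvol-p1`, pre-birth helper; bears on the spine route
`BalabanLadder`, leaf `UV` = stmt-QuantumFields-19351).  Pure soft bookkeeping over the NAMED infinite-volume correlation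
data of `Theorems/BalabanLadderInfVolCeilingsDefs.lean` / `…FloorsDefs.lean`; nothing about Yang–Mills is asserted.  The
input — every torus limit state is `ℤ⁴`-translation invariant — is the tree theorem
`FibreToTorus.isZdTranslationInvariant_of_mem_infiniteVolumeLimitPoints` (Osterwalder–Seiler 1978 §2; the torus states
are translation invariant and the periodic lift intertwines translations).  This is the lattice half of the OS
translation axiom for any «`L → ∞` first» extraction of continuum data from these states: the weights of the
infinite-volume lattice `n`-point functionals depend on the sites only through their differences.  Existence half only;
not a gap, not Clay.

* §1 `plane_add`, `dens_add` — translating the base point is precomposition with the configuration shift: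
  `P^q_{x+v}(U) = P^q_x(θ_{-v} U)`, `A_{x+v}(U) = A_x(θ_{-v} U)`; `integral_comp_configShift` — a translation-invariant
  measure integrates `F ∘ θ_w` like `F`.
* §2 `stateMomentStr_translate`, `stateCov_translate`, `stateK3_translate` — for a `ℤ⁴`-translation-invariant `μ` the
  correlation data are invariant under the simultaneous shift of all sites.
* §3 the same for every `μ ∈ infiniteVolumeLimitPoints r.ρ β` and every `μ ∈ oddTorusLimitPoints r β`
  (`stateMomentStr_translate_of_mem_oddTorusLimitPoints`, …).

References: K. Osterwalder, E. Seiler, Ann. Phys. 110 (1978) §2; E. Seiler, LNP 159 (1982) Ch. 2.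
-/

set_option autoImplicit false

noncomputable section

open MeasureTheory
open scoped BigOperators
open Literature.MathematicalPhysics.QuantumFieldTheory hiding ZdEdge
open Literature.MathematicalPhysics.QuantumLattice
open Literature.Probability.LatticeModels (Site)
open Summit.QuantumFields.YangMills.Cruxes.OSLegsFromFemtoAndGap.DlrCollarTransfer

namespace Summit.QuantumFields.YangMills.Theorems.InfiniteVolume

/-! ## §1 Translating the base point is a configuration shift -/

section Shift

variable {G : Type} [Group G] [TopologicalSpace G] [IsTopologicalGroup G] [CompactSpace G]
  [MeasurableSpace G] [BorelSpace G] (r : LatticeRep G)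

omit [Group G] [TopologicalSpace G] [IsTopologicalGroup G] [CompactSpace G] [BorelSpace G] in
/-- Composing two configuration shifts: `θ_{-x} (θ_{-v} U) = θ_{-(x+v)} U`. [folklore] -/
theorem configShift_neg_configShift_neg (x v : Site 4) (U : LGConfig 4 G) :
    configShift (-x) (configShift (-v) U) = configShift (-(x + v)) U := by
  funext e
  simp only [configShift_apply, sub_neg_eq_add, neg_add_rev, add_assoc]
  congr 2
  abel

omit [IsTopologicalGroup G] [CompactSpace G] [BorelSpace G] in
/-- **Translating the base point of a single-plane field is precomposition with the shift**:
`P^q_{x+v}(U) = P^q_x(θ_{-v} U)`. [folklore] -/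
theorem plane_add (q : Fin 4 × Fin 4) (x v : Site 4) (U : LGConfig 4 G) :
    plane G r q (x + v) U = plane G r q x (configShift (-v) U) := by
  unfold plane
  rw [configShift_neg_configShift_neg]

/-- **Translating the base point of the action density is precomposition with the shift**:
`A_{x+v}(U) = A_x(θ_{-v} U)`. [folklore] -/
theorem dens_add (x v : Site 4) (U : LGConfig 4 G) : dens G r (x + v) U = dens G r x (configShift (-v) U) := by
  unfold dens
  rw [configShift_neg_configShift_neg]

omit [Group G] [TopologicalSpace G] [IsTopologicalGroup G] [CompactSpace G] [BorelSpace G] in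
/-- A `ℤ⁴`-translation-invariant measure integrates `F ∘ θ_w` like `F` (no measurability needed: `θ_w` is a measurable
equivalence). [folklore] -/
theorem integral_comp_configShift {μ : Measure (LGConfig 4 G)} (hμ : IsZdTranslationInvariant μ) (w : Site 4)
    (F : LGConfig 4 G → ℝ) : ∫ U, F (configShift w U) ∂μ = ∫ U, F U ∂μ := by
  have h := integral_map_equiv (configShift (G := G) w) F (μ := μ)
  rw [hμ w] at h
  exact h.symm

end Shift

/-! ## §2 Translation invariance of the correlation data in a translation-invariant state -/

section Invariant

variable {G : Type} [Group G] [TopologicalSpace G] [IsTopologicalGroup G] [CompactSpace G]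
  [MeasurableSpace G] [BorelSpace G] (r : LatticeRep G) {μ : Measure (LGConfig 4 G)}

omit [IsTopologicalGroup G] [CompactSpace G] [BorelSpace G] in
/-- **`stateMomentStr` is invariant under the simultaneous translation of all sites** in a translation-invariant state.
[folklore] -/
theorem stateMomentStr_translate (hμ : IsZdTranslationInvariant μ) (n : ℕ) (q : Fin n → Fin 4 × Fin 4)
    (x : Fin n → Site 4) (v : Site 4) :
    stateMomentStr G r μ n q (fun i => x i + v) = stateMomentStr G r μ n q x := by
  unfold stateMomentStr
  have hmean : ∀ i, ∫ V, plane G r (q i) (x i + v) V ∂μ = ∫ V, plane G r (q i) (x i) V ∂μ := fun i => by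
    simp_rw [plane_add r (q i) (x i) v]
    exact integral_comp_configShift hμ (-v) (plane G r (q i) (x i))
  simp_rw [hmean, plane_add r _ _ v]
  exact integral_comp_configShift hμ (-v) (fun U => ∏ i, (plane G r (q i) (x i) U - ∫ V, plane G r (q i) (x i) V ∂μ))

/-- **`stateCov` is translation invariant** in a translation-invariant state. [folklore] -/
theorem stateCov_translate (hμ : IsZdTranslationInvariant μ) (x y v : Site 4) :
    stateCov G r μ (x + v) (y + v) = stateCov G r μ x y := by
  unfold stateCov
  simp only [dens_add r]
  rw [integral_comp_configShift hμ (-v) (fun U => dens G r x U * dens G r y U),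
    integral_comp_configShift hμ (-v) (dens G r x), integral_comp_configShift hμ (-v) (dens G r y)]

/-- **`stateK3` is translation invariant** in a translation-invariant state. [folklore] -/
theorem stateK3_translate (hμ : IsZdTranslationInvariant μ) (x y z v : Site 4) :
    stateK3 G r μ (x + v) (y + v) (z + v) = stateK3 G r μ x y z := by
  unfold stateK3
  simp only [dens_add r]
  rw [integral_comp_configShift hμ (-v) (fun U => dens G r x U * dens G r y U * dens G r z U),
    integral_comp_configShift hμ (-v) (fun U => dens G r y U * dens G r z U),
    integral_comp_configShift hμ (-v) (fun U => dens G r x U * dens G r z U),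
    integral_comp_configShift hμ (-v) (fun U => dens G r x U * dens G r y U),
    integral_comp_configShift hμ (-v) (dens G r x), integral_comp_configShift hμ (-v) (dens G r y),
    integral_comp_configShift hμ (-v) (dens G r z)]

end Invariant

/-! ## §3 Torus limit states -/

section LimitStates

variable {G : Type} [Group G] [TopologicalSpace G] [IsTopologicalGroup G] [CompactSpace G]
  [MeasurableSpace G] [BorelSpace G] (r : LatticeRep G) {β : ℝ} {μ : Measure (LGConfig 4 G)}

/-- Torus limit states are `ℤ⁴`-translation invariant (tree `FibreToTorus.isZdTranslationInvariant_of_mem_…`, the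
Hausdorff / second-countability side conditions discharged by the faithful representation `r`). [folklore] -/
theorem isZdTranslationInvariant_of_mem_infiniteVolumeLimitPoints (hμ : μ ∈ infiniteVolumeLimitPoints (d := 4) r.ρ β) :
    IsZdTranslationInvariant μ := by
  haveI : SecondCountableTopology G :=
    (r.continuous.isClosedEmbedding r.injective).isEmbedding.secondCountableTopology
  haveI : T2Space G := (r.continuous.isClosedEmbedding r.injective).isEmbedding.t2Space
  exact FibreToTorus.isZdTranslationInvariant_of_mem_infiniteVolumeLimitPoints r.ρ hμ

/-- Odd-torus limit states are `ℤ⁴`-translation invariant. [folklore] -/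
theorem isZdTranslationInvariant_of_mem_oddTorusLimitPoints (hμ : μ ∈ oddTorusLimitPoints r β) :
    IsZdTranslationInvariant μ := by
  obtain ⟨S, hS, h⟩ := hμ
  exact isZdTranslationInvariant_of_mem_infiniteVolumeLimitPoints r
    ⟨fun k => 2 * S k, fun i j hij => Nat.mul_lt_mul_of_pos_left (hS hij) two_pos, h⟩

/-- **The weights of the infinite-volume plane-string functionals depend on the sites only through their
differences**: for every odd-torus limit state, `stateMomentStr μ n q (x + v) = stateMomentStr μ n q x`. [folklore] -/
theorem stateMomentStr_translate_of_mem_oddTorusLimitPoints (hμ : μ ∈ oddTorusLimitPoints r β) (n : ℕ)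
    (q : Fin n → Fin 4 × Fin 4) (x : Fin n → Site 4) (v : Site 4) :
    stateMomentStr G r μ n q (fun i => x i + v) = stateMomentStr G r μ n q x :=
  stateMomentStr_translate r (isZdTranslationInvariant_of_mem_oddTorusLimitPoints r hμ) n q x v

/-- The same for all torus limit states. [folklore] -/
theorem stateMomentStr_translate_of_mem_infiniteVolumeLimitPoints
    (hμ : μ ∈ infiniteVolumeLimitPoints (d := 4) r.ρ β) (n : ℕ) (q : Fin n → Fin 4 × Fin 4) (x : Fin n → Site 4)
    (v : Site 4) : stateMomentStr G r μ n q (fun i => x i + v) = stateMomentStr G r μ n q x :=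
  stateMomentStr_translate r (isZdTranslationInvariant_of_mem_infiniteVolumeLimitPoints r hμ) n q x v

/-- `stateCov` of an odd-torus limit state depends only on the difference of the sites. [folklore] -/
theorem stateCov_translate_of_mem_oddTorusLimitPoints (hμ : μ ∈ oddTorusLimitPoints r β) (x y v : Site 4) :
    stateCov G r μ (x + v) (y + v) = stateCov G r μ x y :=
  stateCov_translate r (isZdTranslationInvariant_of_mem_oddTorusLimitPoints r hμ) x y v

/-- `stateK3` of an odd-torus limit state is translation invariant. [folklore] -/
theorem stateK3_translate_of_mem_oddTorusLimitPoints (hμ : μ ∈ oddTorusLimitPoints r β) (x y z v : Site 4) :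
    stateK3 G r μ (x + v) (y + v) (z + v) = stateK3 G r μ x y z :=
  stateK3_translate r (isZdTranslationInvariant_of_mem_oddTorusLimitPoints r hμ) x y z v

end LimitStates

end Summit.QuantumFields.YangMills.Theorems.InfiniteVolume

end
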